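import Summits.ValiantsHypothesis.ValiantsHypothesis.Theorems.LacunarySymmetroidSOSTauBridge
import Summits.ValiantsHypothesis.ValiantsHypothesis.Theorems.LacunarySymmetroidMatrixDescartesCensusThinLaw

/-!
# Dutta's SOS-τ conjecture and the cell's THIN LAW `DescartesExtremalThin` are incompatible (kernel bookkeeping)

HONEST FRAMING.  Helper file (seat val-v1x-eng-6 g3, cell `val-V1-extremal`, 2026-08-29; `--supports` the crux item
stmt-ValiantsHypothesis-18050 as a helper, no closure claim), a corollary sheet of the bridge
`…LacunarySymmetroidSOSTauBridge` (`SOSTauBridge.posRootLawAt_two_of_sosTauConst`: SOS-τ with constant `c` ⇒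
`PosRootLawAt 2 K (3cK)` for every `K`).  Two NAMED, typed, never-asserted statements of two different routes of the tree
cannot both hold:

* `Theses.SOSTau.SOSTau` (route `SOSTau`, crux stmt-ValiantsHypothesis-18748; Dutta2021 Conj. 1, Burgisser2024Completeness Conj. 4.2;
  with `HutchinsonMagnification` it implies `VP ≠ VNP`, tree `SOSTauAssembly`) says every weighted sum of sparse squares has
  LINEARLY many real zeros in the support-sum;
* `DescartesExtremalThin` (`…CensusDefs`, the object-search cell `pub-symmetroid`'s thin-format conjecture, STRUCTURE §2.2; open parts
  listed by `Census.descartesExtremalThin_iff_open`) says in particular that the symmetric `m = 2` row is Descartes-sharp for EVERY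
  `K`: `ζ_sym(2,K) = C(K+1,2) − 1`, QUADRATIC in `K` — and a symmetric `2 × 2` lacunary determinant is a sum of three sparse squares.

THEOREMS. `posRootLawAt_two_lt_descartes_of_sosTauConst` (quantitative: SOS-τ with constant `c` forces the `m = 2` row STRICTLY
below Descartes from `K = 6c + 2` on), `not_descartesExtremalThin_of_sosTau`, `not_sosTau_of_descartesExtremalThin`,
`not_sosTau_of_formatExtremalAll`, `sosTau_and_descartesExtremalThin_false`.

READING (numbers, not adjectives).  With the tree's Chebyshev calibration `c ≥ 4` (`SOSTau.chebyshevCalibration_proof`) the first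
cell where SOS-τ could bite is `(2, 26)` (`3·4·26 = 312 < 350 = D(2,26)`); the census knows `ζ_sym(2,K) ≥ 4K − 7` there (`VSQ.vsq_law`)
and nothing above; the thin law's open `m = 2` part starts at `K = 6` (`ζ_sym(2,6) ∈ {18,19,20}`, door `DoorA26`).  So the two
conjectures disagree only asymptotically and no finite census row decides between them; this file records the implication, not a
verdict.  Nothing here decides SOS-τ, the thin law, `MatrixDescartes` (stmt-18050) or `VP ≠ VNP`.

[folklore] arithmetic `3cK < K(K+1)/2 − 1` for `K ≥ 6c + 2`; the bridge theorem; bookkeeping.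
-/

-- `Summit.ValiantsHypothesis.ValiantsHypothesis.…` repeats a component by the D-0017 layout
-- (single-conjunct summit), which the `dupNamespace` linter flags; the name is mandated.
set_option linter.dupNamespace false
set_option autoImplicit false

namespace Summit.ValiantsHypothesis.ValiantsHypothesis.Theorems.LacunarySymmetroidMatrixDescartes.SOSTauBridge

open Polynomial Finset
open scoped BigOperators
open Summit.ValiantsHypothesis.ValiantsHypothesis.Theses.SOSTau (SOSTau)
open Summit.ValiantsHypothesis.ValiantsHypothesis.Theorems.MatrixDescartes.Negative (PosRootLawAt)

/-- Arithmetic: `3cK ≤ C(K+1,2) − 2` as soon as `K ≥ 6c + 2`. [folklore] -/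
theorem three_mul_le_choose_sub_two (c K : ℕ) (hK : 6 * c + 2 ≤ K) : 3 * c * K ≤ Nat.choose (2 + K - 1) 2 - 2 := by
  have e : 2 + K - 1 = K + 1 := by omega
  rw [e, Nat.choose_two_right, Nat.add_sub_cancel]
  have h2 : (3 * c * K + 2) * 2 ≤ (K + 1) * K := by nlinarith
  have h3 : 3 * c * K + 2 ≤ (K + 1) * K / 2 := (Nat.le_div_iff_mul_le (by norm_num)).2 h2
  omega

/-- **SOS-τ with constant `c` puts the symmetric `m = 2` row STRICTLY BELOW Descartes from `K = 6c + 2` on**: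
`PosRootLawAt 2 K (C(K+1,2) − 2)`, i.e. `ζ_sym(2,K) ≤ D(2,K) − 1`. [folklore] -/
theorem posRootLawAt_two_lt_descartes_of_sosTauConst (c : ℕ)
    (h : ∀ (s : ℕ) (a : Fin s → ℝ) (g : Fin s → ℝ[X]),
      (∑ i, C (a i) * g i ^ 2).roots.toFinset.card ≤ c * ∑ i, (g i).support.card)
    (K : ℕ) (hK : 6 * c + 2 ≤ K) : PosRootLawAt 2 K (Nat.choose (2 + K - 1) 2 - 2) :=
  fun d S hS => (posRootLawAt_two_of_sosTauConst c h K d S hS).trans (three_mul_le_choose_sub_two c K hK)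

/-- **SOS-τ refutes the thin law**: under `SOSTau` the symmetric `m = 2` row is not Descartes-sharp for all `K`, so
`DescartesExtremalThin` fails (at the format `(2, 6c + 2)`). [folklore] -/
theorem not_descartesExtremalThin_of_sosTau (h : SOSTau) : ¬ DescartesExtremalThin := by
  obtain ⟨c, hc⟩ := h
  intro hT
  have hK : 2 ≤ 6 * c + 2 := by omega
  have hrow := (hT 2 (6 * c + 2) (by norm_num) hK (by simp)).2
  exact hrow (posRootLawAt_two_lt_descartes_of_sosTauConst c hc (6 * c + 2) le_rfl)

/-- **The thin law refutes SOS-τ** (contrapositive form): if `ζ_sym(m,K) = D(m,K)` at every thin format — in particular if the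
symmetric `m = 2` row is Descartes-sharp for every `K` — then Dutta's SOS-τ conjecture is false. [folklore] -/
theorem not_sosTau_of_descartesExtremalThin (hT : DescartesExtremalThin) : ¬ SOSTau :=
  fun h => not_descartesExtremalThin_of_sosTau h hT

/-- The two named conjectures cannot both hold. [folklore] -/
theorem sosTau_and_descartesExtremalThin_false : ¬ (SOSTau ∧ DescartesExtremalThin) :=
  fun h => not_descartesExtremalThin_of_sosTau h.1 h.2

/-- **All-format Descartes-extremality refutes SOS-τ** (via the thin law; `FormatExtremalAll` also refutes `MatrixDescartes`,
`Census.not_matrixDescartes_of_formatExtremal` — so under it BOTH routes' cruxes would be dead). [folklore] -/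
theorem not_sosTau_of_formatExtremalAll (hA : FormatExtremalAll) : ¬ SOSTau :=
  not_sosTau_of_descartesExtremalThin (Census.descartesExtremalThin_of_formatExtremalAll hA)

/-- The `m = 2` slice that matters, isolated: SOS-τ fails as soon as the symmetric `m = 2` row is Descartes-sharp at the single
format `(2, 6c + 2)` for every `c` — a countable family of finite statements `¬ PosRootLawAt 2 (6c+2) (C(6c+3,2) − 2)`. [folklore] -/
theorem not_sosTau_of_two_row_sharp (h : ∀ K : ℕ, 2 ≤ K → ¬ PosRootLawAt 2 K (Nat.choose (2 + K - 1) 2 - 2)) : ¬ SOSTau := by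
  rintro ⟨c, hc⟩
  exact h (6 * c + 2) (by omega) (posRootLawAt_two_lt_descartes_of_sosTauConst c hc (6 * c + 2) le_rfl)

/-! ## Appendix (same seat, same day): the bridge in the crux's own ALL-REAL-ZEROS currency `RealRootLawAt`

`MatrixDescartes` and the K1 census count ALL distinct real zeros (`M(m,K)`, tree `RealRootLawAt`); SOS-τ also counts all real
zeros, so the bridge is even more direct there: no positivity filter is dropped. -/

/-- **SOS-τ with constant `c` bounds the all-real-zeros row `M(2,K)` by `3cK`.** [folklore] -/
theorem realRootLawAt_two_of_sosTauConst (c : ℕ)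
    (h : ∀ (s : ℕ) (a : Fin s → ℝ) (g : Fin s → ℝ[X]),
      (∑ i, C (a i) * g i ^ 2).roots.toFinset.card ≤ c * ∑ i, (g i).support.card)
    (K : ℕ) : RealRootLawAt 2 K (3 * c * K) := by
  intro d S hS
  rw [det_pencil_two_eq_sum_four_squares]
  refine (h 4 _ _).trans ?_
  calc c * _ ≤ c * (3 * K) := Nat.mul_le_mul_left c (sum_card_support_four_squares_le_of_symm d S hS)
    _ = 3 * c * K := by ring

/-- **Dutta's SOS-τ conjecture implies `M(2,K) = O(K)`** (all real zeros of symmetric `(2,K)` pencils). [folklore] -/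
theorem realRootLawAt_two_of_sosTau (h : SOSTau) : ∃ c : ℕ, ∀ K : ℕ, RealRootLawAt 2 K (c * K) := by
  obtain ⟨c, hc⟩ := h
  exact ⟨3 * c, fun K => realRootLawAt_two_of_sosTauConst c hc K⟩

/-- **Under SOS-τ the «all formats Descartes-extremal» branch of the fork is closed**: `FormatExtremalAll` — the hypothesis of
the tree's refutation route `Census.not_matrixDescartes_of_formatExtremal` (format `(K², K)`) — already fails at the thin format
`(2, 6c + 2)`.  (So Dutta's conjecture, if true, removes that particular way of refuting `MatrixDescartes`; it says nothing about
`MatrixDescartes` itself, whose window never contains `m = 2`.) [folklore] -/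
theorem not_formatExtremalAll_of_sosTau (h : SOSTau) : ¬ FormatExtremalAll :=
  fun hA => not_sosTau_of_formatExtremalAll hA h

/-! ## The general (control) column: SOS-τ with constant `c` ends general Descartes-sharpness by `K = 8c + 2` -/

/-- Arithmetic: `4cK ≤ K(K+1)/2 − 2` as soon as `K ≥ 8c + 2`. [folklore] -/
theorem four_mul_le_half_sub_two (c K : ℕ) (hK : 8 * c + 2 ≤ K) : 4 * c * K ≤ K * (K + 1) / 2 - 2 := by
  have h2 : (4 * c * K + 2) * 2 ≤ K * (K + 1) := by nlinarith
  have h3 : 4 * c * K + 2 ≤ K * (K + 1) / 2 := (Nat.le_div_iff_mul_le (by norm_num)).2 h2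
  omega

/-- **SOS-τ with constant `c` puts the GENERAL `(2,K)` column strictly below Descartes from `K = 8c + 2` on**
(`GenPosRootLawAt 2 K (K(K+1)/2 − 2)`, i.e. `ζ_gen(2,K) ≤ D(2,K) − 1`); with the tree's calibration `c ≥ 4` the first cell this can
touch is `K ≥ 32` (`16K < D(2,K)`), the sufficient threshold here being `K = 34`.  Kernel today: general `(2,K)` IS Descartes-sharp for
`K ≤ 6`. [folklore] -/
theorem genPosRootLawAt_two_lt_descartes_of_sosTauConst (c : ℕ)
    (h : ∀ (s : ℕ) (a : Fin s → ℝ) (g : Fin s → ℝ[X]),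
      (∑ i, C (a i) * g i ^ 2).roots.toFinset.card ≤ c * ∑ i, (g i).support.card)
    (K : ℕ) (hK : 8 * c + 2 ≤ K) : KPlusLogSqLaw.GeneralExcess.GenPosRootLawAt 2 K (K * (K + 1) / 2 - 2) :=
  fun d S => (genPosRootLawAt_two_of_sosTauConst c h K d S).trans (four_mul_le_half_sub_two c K hK)

/-- **Under SOS-τ some general `(2,K)` cell is NOT Descartes-sharp** (existential form of `not_sosTau_of_genDescartesSharp`). [folklore] -/
theorem exists_gen_two_not_sharp_of_sosTau (h : SOSTau) :
    ∃ K : ℕ, 2 ≤ K ∧ KPlusLogSqLaw.GeneralExcess.GenPosRootLawAt 2 K (K * (K + 1) / 2 - 2) := by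
  obtain ⟨c, hc⟩ := h
  exact ⟨8 * c + 2, by omega, genPosRootLawAt_two_lt_descartes_of_sosTauConst c hc (8 * c + 2) le_rfl⟩

end Summit.ValiantsHypothesis.ValiantsHypothesis.Theorems.LacunarySymmetroidMatrixDescartes.SOSTauBridge
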